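import Summits.CriticalPhenomena.PercolationContinuityZ3.Theorems.Transplant.FKConnectivityAllQArborealLevelDefs
import Summits.CriticalPhenomena.PercolationContinuityZ3.Theorems.Transplant.FKConnectivityAllQArborealClusterTools
import Summits.CriticalPhenomena.PercolationContinuityZ3.Theorems.Transplant.FKConnectivityAllQArborealContraction
import Summits.CriticalPhenomena.PercolationContinuityZ3.Theorems.Transplant.FKConnectivityAllQClusterDomCex
import Literature.Probability.LatticeModels.FKInterfacePairing
import Literature.Probability.LatticeModels.RandomClusterBoxDuality
import HarnessLib

/-!
# The arboreal gas — an exact-evaluation bridge (`RCEval` data, forests counted by `k + |t| = n`) and the refutation of forest-MM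
# (`ArborealClusterDomAdjPos`) and t-forest-MM (`ArborealClusterDomAdjLevelPos`) on the 6-vertex double cone `K_{1,1,4}`

Support file (`--supports stmt-CriticalPhenomena-4575`), census seat `prim-bschramm-census` (gen 20) of the post-continuity programme; builds on
p205010 (kernel theorem, internal audit signed; external expert review pending).  Definitions (`RCEval.agZQ`, `RCEval.agMassQ`, one listed graph, one
predicate), no named facts, no sorries; standard axioms (`decide`, no `native_decide`).

BRIDGE.  For listed-graph data `D : RCEval` (fk-3 g5) with `q = 1` and no listed loop, a configuration `conf t` is a FOREST iff
`k(conf t) + |t| = n` (`isForestCfg_conf_iff`: induction on `t` with `clusterCount_insert` and fk-1 g10's `isForestCfg_insert_iff`), so the arboreal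
gas `agMeasure D.w` (fk-1 g9) of an event described by a computable predicate is the computable ratio `agMassQ P / agZQ` (`ag_real_eq_div`).

WITNESS (census gen 20, memo bschramm/FROM-census-g20-MM-REFUTED.md §0 (N2)).  `V = Fin 6`, `K_{1,1,4}` (hubs `4, 5`, leaves `0..3`), ALL nine
parameters `8/9` (activity `λ = 8 > 15/2`), `x = 5`, `f = 54`, `𝒰 = {S ∋ 0,1,2,3}`: `μ(𝒰)·μ(f ∈ F) = (1576960/2009417)(668168/2009417) >
1·(524288/2009417) = μ(Ω)·μ(𝒰, f ∈ F)` — i.e. `P(𝒰 | f ∈ F) = 65536/83521 < 1052672/1341249 = P(𝒰 | f ∉ F)`: the tree of `x` and the presence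
of the adjacent pair `f` are NEGATIVELY correlated.  Closed form on `K_{1,1,m}` with `𝒰 = j given leaves`: violated iff `j ≥ 4` and
`λ > (2^j−1)/(j2^{j−1}+2−2^{j+1})` (so the uniform spanning-forest measure on `K_{1,1,6}` violates it: `64/729 < 193/2187`).  By fk-1 g10's
`arborealClusterDomAdjOn_iff_mono` this is a failure of LOCAL stochastic monotonicity of the law of `T_x` in the activity of one pair at `x`
(the uniform-`β` question of Halberstam–Hutchcroft is not touched: census 0 violations through 8 vertices).  (refuted-substantive.)
[cite: Grimmett2006, §1.5 eq. (1.22) (p. 13); §3.9 (pp. 63–65)] [cite: AyyerLinussonRavichandran2025, §7 Conj. 7.1 (p. 22)]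
[cite: HalberstamHutchcroft2024, §1 p. 3]
-/

noncomputable section

namespace Summit.CriticalPhenomena.PercolationContinuityZ3.Theorems

namespace FK

open MeasureTheory Set Literature.Probability.LatticeModels Literature.Probability.Percolation
open BHK2006 DecisionTree
open scoped Classical

namespace RCEval

variable (D : RCEval)

/-- **Computable forest partition function** `Σ_{t : k(t)+|t| = n} wQ t` (the arboreal-gas normaliser of the listed graph, `q` unused).
[cite: Grimmett2006, §1.5 eq. (1.22) (p. 13)] -/
def agZQ : ℚ := ∑ t : Finset (Fin D.m), if D.kB t + t.card = D.n then D.wQ t else 0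

/-- **Computable forest mass of a computable event** `Σ_{t forest, P t} wQ t`. [cite: Grimmett2006, §1.5 eq. (1.22) (p. 13)] -/
def agMassQ (P : Finset (Fin D.m) → Bool) : ℚ := ∑ t : Finset (Fin D.m), if D.kB t + t.card = D.n ∧ P t = true then D.wQ t else 0

variable {D}

/-- `conf (insert i t) = insert (edge i) (conf t)`. [folklore] -/
theorem conf_insert (i : Fin D.m) (t : Finset (Fin D.m)) : D.conf (insert i t) = insert (D.edge i) (D.conf t) := by
  unfold conf
  rw [Finset.image_insert, Finset.coe_insert]

/-- `conf ∅ = ∅`. [folklore] -/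
theorem conf_empty : D.conf ∅ = (∅ : BondConfig (Fin D.n)) := by
  unfold conf
  rw [Finset.image_empty, Finset.coe_empty]

/-- The empty configuration has `n` clusters. [cite: Grimmett2006, §1.2 eq. (1.1) (p. 4)] -/
theorem clusterCount_empty_fin (n : ℕ) : clusterCount (∅ : BondConfig (Fin n)) ∅ = n := by
  unfold clusterCount
  have h : openGraph (∅ : BondConfig (Fin n)) = ⊥ := by
    ext a b; simp [openGraph_adj]
  rw [wired_empty, sup_bot_eq, h, card_connectedComponent_bot, Nat.card_eq_fintype_card, Fintype.card_fin]

/-- **Forests by counting**: along the listed pairs, `n ≤ k(conf t) + |t|`, with equality iff `conf t` is a forest (no listed loops).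
[cite: Grimmett2006, §1.5 (p. 13)] -/
theorem le_clusterCount_add_card_and_iff (hD : D.Valid) (hl : ∀ i, D.src i ≠ D.dst i) (t : Finset (Fin D.m)) :
    D.n ≤ clusterCount (D.conf t) ∅ + t.card ∧ (IsForestCfg (D.conf t) ↔ clusterCount (D.conf t) ∅ + t.card = D.n) := by
  induction t using Finset.induction_on with
  | empty =>
    rw [conf_empty, clusterCount_empty_fin, Finset.card_empty, add_zero]
    exact ⟨le_rfl, ⟨fun _ => rfl, fun _ => isForestCfg_empty⟩⟩
  | insert i t hi ih =>
    obtain ⟨ihle, ihiff⟩ := ih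
    have hnot : s(D.src i, D.dst i) ∉ D.conf t := fun hmem => hi ((edge_mem_conf hD t i).1 hmem)
    have hcc := clusterCount_insert (t.image D.edge) (D.src i) (D.dst i) (∅ : Set (Fin D.n))
    have hforest := isForestCfg_insert_iff (hl i) hnot
    rw [conf_insert, Finset.card_insert_of_notMem hi]
    rw [Finset.coe_insert] at hcc
    change clusterCount (insert s(D.src i, D.dst i) (D.conf t)) ∅ +
        (if (openGraph (D.conf t) ⊔ wired (∅ : Set (Fin D.n))).Reachable (D.src i) (D.dst i) then 0 else 1) =
      clusterCount (D.conf t) ∅ at hcc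
    by_cases hr : (openGraph (D.conf t) ⊔ wired (∅ : Set (Fin D.n))).Reachable (D.src i) (D.dst i)
    · rw [if_pos hr, add_zero] at hcc
      have hr' : (openGraph (D.conf t)).Reachable (D.src i) (D.dst i) := by rwa [wired_empty, sup_bot_eq] at hr
      change D.n ≤ clusterCount (insert s(D.src i, D.dst i) (D.conf t)) ∅ + (t.card + 1) ∧
        (IsForestCfg (insert s(D.src i, D.dst i) (D.conf t)) ↔ clusterCount (insert s(D.src i, D.dst i) (D.conf t)) ∅ + (t.card + 1) = D.n)
      rw [hcc, hforest]
      exact ⟨by omega, ⟨fun h => absurd hr' h.2, fun h => by omega⟩⟩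
    · rw [if_neg hr] at hcc
      have hr' : ¬ (openGraph (D.conf t)).Reachable (D.src i) (D.dst i) := by rwa [wired_empty, sup_bot_eq] at hr
      change D.n ≤ clusterCount (insert s(D.src i, D.dst i) (D.conf t)) ∅ + (t.card + 1) ∧
        (IsForestCfg (insert s(D.src i, D.dst i) (D.conf t)) ↔ clusterCount (insert s(D.src i, D.dst i) (D.conf t)) ∅ + (t.card + 1) = D.n)
      rw [hforest]
      refine ⟨by omega, ⟨fun h => ?_, fun h => ⟨ihiff.2 (by omega), hr'⟩⟩⟩
      have := ihiff.1 h.1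
      omega

/-- **`conf t` is a forest iff `kB t + |t| = n`** (listed data without loops). [cite: Grimmett2006, §1.5 (p. 13)] -/
theorem isForestCfg_conf_iff (hD : D.Valid) (hl : ∀ i, D.src i ≠ D.dst i) (t : Finset (Fin D.m)) :
    IsForestCfg (D.conf t) ↔ D.kB t + t.card = D.n := by
  rw [(le_clusterCount_add_card_and_iff hD hl t).2, clusterCount_conf]

/-- With `q = 1` the random-cluster weight is the product weight, so weighted sums transfer to the listed configurations.
[cite: Grimmett2006, §1.4 eq. (1.20) (p. 15)] -/
theorem sum_weight_mul (hD : D.Valid) (hq : D.q = 1) (f : BondConfig (Fin D.n) → ℝ) :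
    ∑ ω : BondConfig (Fin D.n), weight (fun e => (D.w e : ℝ)) ω * f ω = ∑ t : Finset (Fin D.m), (D.wQ t : ℝ) * f (D.conf t) := by
  have h := sum_rcWeightW_mul hD f
  have hw : ∀ ω : BondConfig (Fin D.n), rcWeightW D.w (D.q : ℝ) ∅ ω = weight (fun e => (D.w e : ℝ)) ω := by
    intro ω; unfold rcWeightW; rw [hq, Rat.cast_one, one_pow, mul_one]
  have hm : ∀ t : Finset (Fin D.m), (D.mQ t : ℝ) = (D.wQ t : ℝ) := by
    intro t; unfold mQ; rw [hq, one_pow, mul_one]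
  simp only [hw, hm] at h
  exact h

/-- **The arboreal-gas normaliser is `agZQ`.** [cite: Grimmett2006, §1.5 eq. (1.22) (p. 13)] -/
theorem agPartition_eq (hD : D.Valid) (hl : ∀ i, D.src i ≠ D.dst i) (hq : D.q = 1) : agPartition D.w = (D.agZQ : ℝ) := by
  unfold agPartition agZQ
  have h := sum_weight_mul hD hq (fun ω => if IsForestCfg ω then 1 else 0)
  have hl' : ∀ ω : BondConfig (Fin D.n), agWeight D.w ω = weight (fun e => (D.w e : ℝ)) ω * (if IsForestCfg ω then 1 else 0) := by
    intro ω
    by_cases hF : IsForestCfg ω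
    · rw [agWeight_of_isForestCfg D.w hF, if_pos hF, mul_one]
    · rw [agWeight_of_not_isForestCfg D.w hF, if_neg hF, mul_zero]
  simp only [hl']
  rw [h, Rat.cast_sum]
  refine Finset.sum_congr rfl fun t _ => ?_
  by_cases hF : IsForestCfg (D.conf t)
  · rw [if_pos hF, if_pos ((isForestCfg_conf_iff hD hl t).1 hF), mul_one]
  · rw [if_neg hF, if_neg (fun h => hF ((isForestCfg_conf_iff hD hl t).2 h)), mul_zero, Rat.cast_zero]

/-- **Forest mass of a computable event.** [cite: Grimmett2006, §1.5 eq. (1.22) (p. 13)] -/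
theorem sum_agWeight_ind_eq (hD : D.Valid) (hl : ∀ i, D.src i ≠ D.dst i) (hq : D.q = 1) {X : Set (BondConfig (Fin D.n))}
    {P : Finset (Fin D.m) → Bool} (h : ∀ t, D.conf t ∈ X ↔ P t = true) :
    ∑ ω : BondConfig (Fin D.n), agWeight D.w ω * ind X ω = (D.agMassQ P : ℝ) := by
  unfold agMassQ
  have hs := sum_weight_mul hD hq (fun ω => (if IsForestCfg ω then 1 else 0) * ind X ω)
  have hl' : ∀ ω : BondConfig (Fin D.n), agWeight D.w ω * ind X ω =
      weight (fun e => (D.w e : ℝ)) ω * ((if IsForestCfg ω then 1 else 0) * ind X ω) := by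
    intro ω
    by_cases hF : IsForestCfg ω
    · rw [agWeight_of_isForestCfg D.w hF, if_pos hF, one_mul]
    · rw [agWeight_of_not_isForestCfg D.w hF, if_neg hF, zero_mul, mul_zero]
  simp only [hl']
  rw [hs, Rat.cast_sum]
  refine Finset.sum_congr rfl fun t _ => ?_
  by_cases hF : IsForestCfg (D.conf t)
  · have hk := (isForestCfg_conf_iff hD hl t).1 hF
    by_cases hP : P t = true
    · rw [if_pos hF, ind_of_mem ((h t).2 hP), if_pos ⟨hk, hP⟩, one_mul, mul_one]
    · rw [if_pos hF, ind_of_not_mem (fun hX => hP ((h t).1 hX)), if_neg (fun hh => hP hh.2), mul_zero, mul_zero, Rat.cast_zero]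
  · rw [if_neg hF, zero_mul, mul_zero, if_neg (fun hh => hF ((isForestCfg_conf_iff hD hl t).2 hh.1)), Rat.cast_zero]

/-- **The arboreal gas of a computable event is the computable ratio `agMassQ P / agZQ`.** [cite: Grimmett2006, §1.5 eq. (1.22) (p. 13)] -/
theorem ag_real_eq_div (hD : D.Valid) (hl : ∀ i, D.src i ≠ D.dst i) (hq : D.q = 1) {X : Set (BondConfig (Fin D.n))}
    {P : Finset (Fin D.m) → Bool} (h : ∀ t, D.conf t ∈ X ↔ P t = true) :
    (agMeasure D.w).real X = ((D.agMassQ P / D.agZQ : ℚ) : ℝ) := by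
  rw [agMeasure_real_eq_agE, agE_eq_sum_div, sum_agWeight_ind_eq hD hl hq h, agPartition_eq hD hl hq]
  push_cast
  rfl

end RCEval

namespace ArborealClusterDomCex

/-- The listed `K_{1,1,4}` on `Fin 6` (hub pair `54` first, then the eight leaf–hub pairs), all parameters `8/9` (activity `8`), `q = 1`.
[cite: Grimmett2006, §1.5 eq. (1.22) (p. 13)] -/
abbrev fa : RCEval :=
  ⟨6, 9, ![5, 0, 1, 2, 3, 0, 1, 2, 3], ![4, 4, 4, 4, 4, 5, 5, 5, 5],
    ![8 / 9, 8 / 9, 8 / 9, 8 / 9, 8 / 9, 8 / 9, 8 / 9, 8 / 9, 8 / 9], 1⟩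

/-- Validity of the data. [folklore] -/
theorem valid : fa.Valid := by decide +kernel
/-- No listed loop. [folklore] -/
theorem noloop : ∀ i, fa.src i ≠ fa.dst i := by decide +kernel
/-- `q = 1`. [folklore] -/
theorem q_one : fa.q = 1 := rfl

/-- Computable predicate of `{T_5 ∋ 0, 1, 2, 3}`. [folklore] -/
def pU (t : Finset (Fin 9)) : Bool := fa.reachB t 5 0 && (fa.reachB t 5 1 && (fa.reachB t 5 2 && fa.reachB t 5 3))

/-- Forest normaliser: `Σ_F 8^{|F|}/9^9 = 2009417/9^9`. [cite: Grimmett2006, §1.5 eq. (1.22) (p. 13)] -/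
theorem zq : fa.agZQ = 2009417 / 387420489 := by decide +kernel
/-- Mass of `{T_5 ⊇ leaves}`. [cite: Grimmett2006, §1.5 eq. (1.22) (p. 13)] -/
theorem mU : fa.agMassQ pU = 1576960 / 387420489 := by decide +kernel
/-- Mass of `{f ∈ F}`. [cite: Grimmett2006, §1.5 eq. (1.22) (p. 13)] -/
theorem mF : fa.agMassQ (fun t => decide ((0 : Fin 9) ∈ t)) = 668168 / 387420489 := by decide +kernel
/-- Mass of `{T_5 ⊇ leaves, f ∈ F}`. [cite: Grimmett2006, §1.5 eq. (1.22) (p. 13)] -/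
theorem mUF : fa.agMassQ (fun t => pU t && decide ((0 : Fin 9) ∈ t)) = 524288 / 387420489 := by decide +kernel
/-- Mass of `Ω`. [cite: Grimmett2006, §1.5 eq. (1.22) (p. 13)] -/
theorem mAll : fa.agMassQ (fun _ => true) = 2009417 / 387420489 := by decide +kernel

/-- `conf t ∈ {T_5 ∋ 0,1,2,3}` iff `pU t`. [folklore] -/
theorem conf_mem_U (t : Finset (Fin 9)) :
    fa.conf t ∈ clusterIn (5 : Fin 6) {S : Set (Fin 6) | (0 : Fin 6) ∈ S ∧ (1 : Fin 6) ∈ S ∧ (2 : Fin 6) ∈ S ∧ (3 : Fin 6) ∈ S} ↔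
      pU t = true := by
  unfold pU
  rw [Bool.and_eq_true, Bool.and_eq_true, Bool.and_eq_true, RCEval.reachB_iff, RCEval.reachB_iff, RCEval.reachB_iff, RCEval.reachB_iff]
  rfl

/-- `conf t ∋ f` iff the hub pair (index `0`) is in `t`. [folklore] -/
theorem conf_mem_F (t : Finset (Fin 9)) :
    fa.conf t ∈ {ω : BondConfig (Fin 6) | s((5 : Fin 6), (4 : Fin 6)) ∈ ω} ↔ decide ((0 : Fin 9) ∈ t) = true := by
  rw [decide_eq_true_iff, Set.mem_setOf_eq]
  have e0 : fa.edge 0 = s((5 : Fin 6), (4 : Fin 6)) := rfl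
  rw [← e0]
  exact RCEval.edge_mem_conf valid t 0

/-- `conf t ∈ {T_5 ∋ 0,1,2,3} ∩ {f ∈ ω}` iff `pU t ∧ 0 ∈ t`. [folklore] -/
theorem conf_mem_UF (t : Finset (Fin 9)) :
    fa.conf t ∈ clusterIn (5 : Fin 6) {S : Set (Fin 6) | (0 : Fin 6) ∈ S ∧ (1 : Fin 6) ∈ S ∧ (2 : Fin 6) ∈ S ∧ (3 : Fin 6) ∈ S} ∩
        {ω : BondConfig (Fin 6) | s((5 : Fin 6), (4 : Fin 6)) ∈ ω} ↔
      (pU t && decide ((0 : Fin 9) ∈ t)) = true := by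
  rw [Set.mem_inter_iff, conf_mem_U, conf_mem_F, Bool.and_eq_true]

/-- `conf t ∈ univ` iff `true`. [folklore] -/
theorem conf_mem_univ (t : Finset (Fin 9)) : fa.conf t ∈ (Set.univ : Set (BondConfig (Fin 6))) ↔ (fun _ => true) t = true :=
  ⟨fun _ => rfl, fun _ => Set.mem_univ _⟩

end ArborealClusterDomCex

open ArborealClusterDomCex

/-- **forest-MM fails on `Fin 6`**: `¬ ArborealClusterDomAdjOn (Fin 6)` — on `K_{1,1,4}` with all activities `8` the tree of the hub `5` and the
hub pair are negatively correlated through `{T_5 ⊇ leaves}`: `(1576960·668168) > 2009417·524288` (all over `2009417²`).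
[cite: Grimmett2006, §1.5 eq. (1.22) (p. 13); §3.9 (pp. 63–65)] [cite: AyyerLinussonRavichandran2025, §7 Conj. 7.1 (p. 22)] -/
theorem not_arborealClusterDomAdjOn_fin_six : ¬ ArborealClusterDomAdjOn (Fin 6) := by
  intro h
  have key := h fa.w 5 4 {S : Set (Fin 6) | (0 : Fin 6) ∈ S ∧ (1 : Fin 6) ∈ S ∧ (2 : Fin 6) ∈ S ∧ (3 : Fin 6) ∈ S}
    ClusterDomCex.isUpperSet_U
  rw [RCEval.ag_real_eq_div valid noloop q_one conf_mem_U, RCEval.ag_real_eq_div valid noloop q_one conf_mem_F,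
    RCEval.ag_real_eq_div valid noloop q_one conf_mem_univ, RCEval.ag_real_eq_div valid noloop q_one conf_mem_UF,
    zq, mU, mF, mUF, mAll] at key
  norm_num at key

/-- **forest-MM fails: `¬ ArborealClusterDomAdjPos`** (fk-1 g9's node; refuted-substantive — on `K_{1,1,m}` it fails for every activity
`> (2^m−1)/(m2^{m−1}+2−2^{m+1})`, e.g. for the uniform spanning-forest measure on `K_{1,1,6}`).
[cite: Grimmett2006, §1.5 eq. (1.22) (p. 13); §3.9 (pp. 63–65)] [cite: AyyerLinussonRavichandran2025, §7 Conj. 7.1 (p. 22)] -/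
theorem not_arborealClusterDomAdjPos : ¬ ArborealClusterDomAdjPos := fun h => not_arborealClusterDomAdjOn_fin_six (h 6)

/-- **t-forest-MM fails: `¬ ArborealClusterDomAdjLevelPos`** (fk-1 g10's levelwise node; levelwise ⇒ valuewise). [cite: Grimmett2006, §1.5 eq. (1.22) (p. 13)] -/
theorem not_arborealClusterDomAdjLevelPos : ¬ ArborealClusterDomAdjLevelPos := fun h =>
  not_arborealClusterDomAdjPos (arborealClusterDomAdjPos_of_level h)

end FK

end Summit.CriticalPhenomena.PercolationContinuityZ3.Theorems

end
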